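import Literature.AlgebraicGeometry.KTheory.ContinuousKZero
import Literature.AlgebraicGeometry.Motives.CrystallineRealization
import HarnessLib

/-!
# The Bloch–Esnault–Kerz `p`-adic lifting criterion for `K₀ ⊗ ℚ`-classes (Thm. 1.3)

S. Bloch, H. Esnault, M. Kerz, *p-adic deformation of algebraic cycle classes*, Invent. math. 195
(2014) 673–722 (arXiv:1203.2776, read pp. 1–4), **Theorem 1.3**:

> Let `k` be a perfect field of characteristic `p > 0`, let `X/W` be smooth projective scheme over
> `W` with closed fibre `X₁`. Assume `p > d + 6`, where `d = dim(X₁)`. Then for `ξ₁ ∈ K₀(X₁)_ℚ` the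
> following are equivalent:
> (a) `Φ⁻¹ ∘ ch(ξ₁) ∈ ⊕ᵣ Fʳ H²ʳ_dR` (the Hodge filtration of the de Rham cohomology of the lift,
>     `H_dR(X_K/K)` rationally, through Berthelot's comparison `Φ : H_dR(X/W) ≅ H_cris(X₁/W)`);
> (b) there is `ξ̂ ∈ (lim_n K₀(X_n))_ℚ` such that `ξ̂|_{X₁} = ξ₁ ∈ K₀(X₁)_ℚ`,

where `W = W(k)`, `K = Frac W`, `X_n = X ⊗_W W/pⁿ`, `ch : K₀(X₁) → ⊕ᵣ H²ʳ_cris(X₁/W)_K` is the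
crystalline Chern character ((2.11)–(2.12) of the paper) and `- _ℚ = - ⊗_ℤ ℚ`.

## Formal shape (the named-fact pattern of `Motives/CrystallineRealization`)

Crystalline cohomology, the Berthelot–Ogus comparison and the crystalline Chern character are not
constructible in Mathlib; the tree records them as the hypothesis structure
`CrystallineRealization p k` (`Motives/CrystallineRealization.lean`), and deep theorems about the
CLASSICAL realization are `Prop`-valued predicates of an explicit `C : CrystallineRealization p k`,
consumed as hypotheses `(h : Statement C)` (worked instances there: `BerthelotOgusLineBundleLifting C`;
`CycleClassIsChernCharacter C` in `Motives/CrystallineRiemannRoch.lean`, whose universal closure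
over all `C` is refuted by the zero-Chern re-decoration). Theorem 1.3 is vendored the same way, as
the predicate **`BlochEsnaultKerzLifting C`**, over the tree's real vocabulary:

* `K₀(X₁)_ℚ` = `KZeroRat (specialFibre 𝒳).left` (`KTheory/GrothendieckGroup.lean`; `specialFibre`
  of `Motives/CrystallineRealization.lean` is `𝒳 ⊗_W k`);
* `(lim_n K₀(X_n))_ℚ` = `ContinuousKZeroRat (Ideal.span {p}) 𝒳` (`KTheory/ContinuousKZero.lean`,
  `⊗ ℚ` after the limit, as printed), whose `specialFibre` projection lands in `K₀(𝒳 ⊗_W W/p)_ℚ`;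
  "`ξ̂|_{X₁} = ξ₁`" is read in `K₀(𝒳 ⊗_W k)_ℚ` after pulling back along the canonical morphism
  `𝒳 ⊗_W k → 𝒳 ⊗_W W/p` (`specialFibreToTower 𝒳`, the morphism `WittScheme.specialFibreToThickening 𝒳 0`
  written against the `KTheory` tower; an isomorphism since `W(k)/p = k` for perfect `k`);
* `ch` on `K₀(X₁)_ℚ`: the additive extension `C.chKZero` / `C.chKZeroRat` of the structure's
  Chern character of vector bundles `C.chCris` (universal property `KZero.lift`, additivity axiom
  `chCris_shortExact`), defined here, with `chKZeroRat_of`;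
* (a) = `C.HodgeConditionKZeroRat 𝒳 ξ₁ : ∀ r, C.bo 𝒳 (2r) (ch_r ξ₁) ∈ Fʳ H²ʳ_dR(X_K/K)` — on the class
  of one bundle this is the tree's `C.HodgeCondition` (`hodgeConditionKZeroRat_of`);
* hypotheses: `IsSmoothProperModel d 𝒳` (smooth of relative dimension `d`, proper, fibres smooth
  projective geometrically integral of dimension `d` — so `d = dim X₁`; the geometric irreducibility
  built into that tree structure is an extra restriction relative to the paper, i.e. the vendored
  statement covers fewer `𝒳`, never more), `IsProjectiveOverRing 𝒳` (a closed `W`-immersion into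
  some `ℙᴺ_W`: "projective over `W`"; `projectiveSpaceOver`, `IsProjectiveOverRing` generalise
  verbatim the field-base `Motives.projectiveSpace` / `IsProjectiveOver`, see
  `projectiveSpaceOver_eq`, `isProjectiveOverRing_iff`), and `d + 6 < p`.

Also proved: the elementary half of (b) ⇒ (a) for classes that even ALGEBRAIZE
(`hodgeConditionKZeroRat_map_specialFibreι`: `ξ|_{X₁}` satisfies (a) for `ξ ∈ K₀(𝒳)_ℚ`, from the
structure's comparison axiom `bo_chCris`), and that such classes satisfy (b)
(`exists_lift_of_map_specialFibreι`, via `ContinuousKZeroRat.restrict`).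

What is NOT here: the proof (syntomic/motivic pro-complexes, continuous Chow groups and continuous
`K`-theory, §§2–9 of the paper); the integral intermediate Theorem 8.5/`def.thm`; the improvements of
Antieau–Mathew–Morrow–Nikolaus 2022 (Beilinson fibre square) on the bound `p > d + 6` — to be
recorded as a separate predicate if a route uses them. Consumer: route
`HodgeConjecture/SupersingularIsotypicLift` (crux ALG / `IsotypicClassesAlgebraic`,
stmt-HodgeConjecture-3116).

## References

* S. Bloch, H. Esnault, M. Kerz, Invent. math. 195 (2014), doi:10.1007/s00222-013-0461-4,
  arXiv:1203.2776: §1, Theorem 1.3; §2 (2.11)–(2.12). [`BlochEsnaultKerz2014pAdic`]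
* P. Berthelot, A. Ogus, *F-isocrystals and de Rham cohomology. I*, Invent. Math. 72 (1983).
  [`BerthelotOgus1983`]
* B. Antieau, A. Mathew, M. Morrow, T. Nikolaus, *On the Beilinson fiber square*, Duke Math. J. 171
  (2022). [`AntieauMathewMorrowNikolaus2022`]
-/

universe u

open CategoryTheory Limits AlgebraicGeometry TensorProduct
open Literature.AlgebraicGeometry.Motives Literature.AlgebraicGeometry.KTheory
open Literature.AlgebraicGeometry.Motives.WittScheme
open scoped Isocrystal

noncomputable section

namespace Literature.AlgebraicGeometry.Crystalline

/-! ## Projectivity over a ring base -/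

section Projective

variable (n : ℕ) (O : Type u) [CommRing O]

/-- Projective `n`-space `ℙⁿ_O = Proj O[x₀, …, xₙ]` over a commutative ring `O`, as an `O`-scheme:
verbatim the tree's `Literature.AlgebraicGeometry.Motives.projectiveSpace` with the field base
replaced by a ring (`projectiveSpaceOver_eq`; Hartshorne II.2.5, II.4; Stacks 01M6). [folklore] -/
def projectiveSpaceOver : SchemeOver O :=
  letI := MvPolynomial.gradedAlgebra (σ := Fin (n + 1)) (R := O)
  Over.mk (Proj.toSpecZero (MvPolynomial.homogeneousSubmodule (Fin (n + 1)) O) ≫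
    Spec.map (CommRingCat.ofHom
      (algebraMap O (MvPolynomial.homogeneousSubmodule (Fin (n + 1)) O 0))))

/-- Over a field, `projectiveSpaceOver` is the tree's `projectiveSpace` (definitionally). [folklore] -/
theorem projectiveSpaceOver_eq (k : Type u) [Field k] : projectiveSpaceOver n k = projectiveSpace n k :=
  rfl

variable {O}

/-- An `O`-scheme is **projective over the ring `O`** if it admits a closed `O`-immersion into some
`ℙⁿ_O` (Hartshorne II.4, before 4.9; Stacks 01W7; EGA II 5.5); verbatim
`Literature.AlgebraicGeometry.Motives.IsProjectiveOver` with a ring base (`isProjectiveOverRing_iff`).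
The hypothesis "`X/W` smooth projective scheme over `W`" of Bloch–Esnault–Kerz 2014, Thm. 1.3.
[folklore] -/
def IsProjectiveOverRing (X : SchemeOver O) : Prop :=
  ∃ (n : ℕ) (ι : X ⟶ projectiveSpaceOver n O), IsClosedImmersion ι.left

/-- Over a field, `IsProjectiveOverRing` is the tree's `IsProjectiveOver`. [folklore] -/
theorem isProjectiveOverRing_iff {k : Type u} [Field k] (X : SchemeOver k) :
    IsProjectiveOverRing X ↔ IsProjectiveOver X :=
  Iff.rfl

end Projective

/-! ## The crystalline Chern character on `K₀` and `K₀ ⊗ ℚ` -/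

section Chern

variable {p : ℕ} [Fact p.Prime] {k : Type u} [Field k] [CharP k p] [PerfectRing k p]
  (C : CrystallineRealization p k)

/-- The degree-`2r` crystalline Chern character **`ch_r : K₀(X) →+ H²ʳ_cris(X/W)_K`** of a
`k`-scheme `X`, the additive extension of the structure's Chern character of vector bundles
`C.chCris` (additive on short exact sequences of vector bundles, `chCris_shortExact`) through the
universal property of `K₀` (`KZero.lift`; Bloch–Esnault–Kerz 2014, §2, last display:
`ch : K₀(X₁) → ⊕ᵣ H²ʳ_cris(X₁/W)_ℚ`). [cite: BlochEsnaultKerz2014pAdic, §2 (2.11)–(2.12)] -/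
def _root_.Literature.AlgebraicGeometry.Motives.CrystallineRealization.chKZero
    (X : SchemeOver k) (r : ℕ) : KZero X.left →+ C.obj X (2 * r) :=
  KZero.lift (fun E _ => C.chCris X E r) fun S hS h₁ _ h₃ =>
    C.chCris_shortExact S hS h₁.isVectorBundle h₃.isVectorBundle r

/-- `ch_r [E] = ch_r(E)` on the class of a vector bundle. [folklore] -/
@[simp]
theorem _root_.Literature.AlgebraicGeometry.Motives.CrystallineRealization.chKZero_of
    (X : SchemeOver k) (r : ℕ) (E : X.left.Modules) (hE : IsFiniteLocallyFree E) :
    C.chKZero X r (KZero.of E hE) = C.chCris X E r :=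
  KZero.lift_of _ _ E hE

/-- The `ℤ`-bilinear map `(a, x) ↦ a · ch_r(x)`, `ℚ × K₀(X) → H²ʳ(X)`, defining `ch_r` on
`K₀(X) ⊗ ℚ`. [folklore] -/
def _root_.Literature.AlgebraicGeometry.Motives.CrystallineRealization.chKZeroBilin
    (X : SchemeOver k) (r : ℕ) : ℚ →ₗ[ℤ] KZero X.left →ₗ[ℤ] C.obj X (2 * r) :=
  LinearMap.mk₂ ℤ (fun a x => ((a : ℚ) : K(p, k)) • C.chKZero X r x)
    (fun a b x => by rw [Rat.cast_add, add_smul])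
    (fun c a x => by
      rw [zsmul_eq_mul, Rat.cast_mul, Rat.cast_intCast, mul_smul, Int.cast_smul_eq_zsmul])
    (fun a x y => by rw [map_add, smul_add])
    (fun c a x => by rw [map_zsmul, smul_comm])

/-- The degree-`2r` crystalline Chern character **`ch_r : K₀(X)_ℚ →+ H²ʳ_cris(X/W)_K`** on the
rational Grothendieck group (`a ⊗ x ↦ a · ch_r(x)`; Bloch–Esnault–Kerz 2014, Thm. 1.3:
`ch(ξ₁)`, `ξ₁ ∈ K₀(X₁)_ℚ`). [cite: BlochEsnaultKerz2014pAdic, Thm. 1.3] -/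
def _root_.Literature.AlgebraicGeometry.Motives.CrystallineRealization.chKZeroRat
    (X : SchemeOver k) (r : ℕ) : KZeroRat X.left →+ C.obj X (2 * r) :=
  (TensorProduct.lift (C.chKZeroBilin X r)).toAddMonoidHom

/-- `ch_r (a ⊗ x) = a · ch_r(x)`. [folklore] -/
@[simp]
theorem _root_.Literature.AlgebraicGeometry.Motives.CrystallineRealization.chKZeroRat_tmul
    (X : SchemeOver k) (r : ℕ) (a : ℚ) (x : KZero X.left) :
    C.chKZeroRat X r (a ⊗ₜ[ℤ] x) = ((a : ℚ) : K(p, k)) • C.chKZero X r x :=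
  rfl

/-- `ch_r [E]_ℚ = ch_r(E)` on the rational class of a vector bundle. [folklore] -/
@[simp]
theorem _root_.Literature.AlgebraicGeometry.Motives.CrystallineRealization.chKZeroRat_of
    (X : SchemeOver k) (r : ℕ) (E : X.left.Modules) (hE : IsFiniteLocallyFree E) :
    C.chKZeroRat X r (KZeroRat.of E hE) = C.chCris X E r := by
  change C.chKZeroRat X r ((1 : ℚ) ⊗ₜ[ℤ] KZero.of E hE) = _
  rw [C.chKZeroRat_tmul, C.chKZero_of, Rat.cast_one, one_smul]

/-- **Bloch–Esnault–Kerz's condition (a)** for a class `ξ₁ ∈ K₀(X₁)_ℚ` on the special fibre of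
`𝒳/W`: `Φ⁻¹ ∘ ch(ξ₁) ∈ ⊕ᵣ Fʳ H²ʳ_dR(X_K/K)`, i.e. every component `ch_r(ξ₁)` is carried by the
Berthelot–Ogus map `C.bo` into the Hodge filtration of the generic fibre (Bloch–Esnault–Kerz 2014,
Thm. 1.3 (a); extends the tree's `C.HodgeCondition` from one bundle to `K₀ ⊗ ℚ`-classes,
`hodgeConditionKZeroRat_of`). [cite: BlochEsnaultKerz2014pAdic, Thm. 1.3 (a)] -/
def _root_.Literature.AlgebraicGeometry.Motives.CrystallineRealization.HodgeConditionKZeroRat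
    (𝒳 : SchemeOver (WittVector p k)) (ξ₁ : KZeroRat (specialFibre 𝒳).left) : Prop :=
  ∀ r : ℕ, C.bo 𝒳 (2 * r) (C.chKZeroRat (specialFibre 𝒳) r ξ₁) ∈ C.dR.fil (2 * r) r

/-- On the class of a vector bundle `E₁` on the special fibre, condition (a) is the tree's
`C.HodgeCondition 𝒳 E₁`. [folklore] -/
theorem _root_.Literature.AlgebraicGeometry.Motives.CrystallineRealization.hodgeConditionKZeroRat_of
    (𝒳 : SchemeOver (WittVector p k)) (E₁ : (specialFibre 𝒳).left.Modules)
    (hE : IsFiniteLocallyFree E₁) :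
    C.HodgeConditionKZeroRat 𝒳 (KZeroRat.of E₁ hE) ↔ C.HodgeCondition 𝒳 E₁ := by
  simp only [CrystallineRealization.HodgeConditionKZeroRat, C.chKZeroRat_of,
    CrystallineRealization.HodgeCondition]

end Chern

/-! ## The special fibre inside the `p`-adic tower -/

section Tower

variable {p : ℕ} [Fact p.Prime] {k : Type u} [CommRing k] [CharP k p]

/-- The canonical closed immersion **`X_k = 𝒳 ⊗_W k ⟶ 𝒳 ⊗_W W/p = X_0`** of the special fibre
(`WittScheme.specialFibre`) into the bottom stage of the `p`-adic thickening tower of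
`KTheory/ContinuousKZero.lean` (`KTheory.thickening (p) 𝒳 0`), induced by the residue map
`W/p → k` (`wittQuotToResidue p k 0`); an isomorphism, `k` being perfect (`W(k)/p = k`). The same
morphism as `WittScheme.specialFibreToThickening 𝒳 0`, written against the `KTheory` presentation of
`𝒳 ⊗_W W/p` as `pullback 𝒳.hom (truncSpecι (p) 0)`. [folklore] -/
def specialFibreToTower (𝒳 : SchemeOver (WittVector p k)) :
    (specialFibre 𝒳).left ⟶ KTheory.thickening (Ideal.span {(p : WittVector p k)}) 𝒳 0 :=
  pullback.map 𝒳.hom (Spec.map (CommRingCat.ofHom WittVector.constantCoeff)) 𝒳.hom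
    (truncSpecι (Ideal.span {(p : WittVector p k)}) 0)
    (𝟙 _) (Spec.map (CommRingCat.ofHom (wittQuotToResidue p k 0))) (𝟙 _)
    (by rw [Category.comp_id, Category.id_comp])
    (by
      rw [Category.comp_id, truncSpecι, ← Spec.map_comp, ← CommRingCat.ofHom_comp]
      exact congrArg (fun f => Spec.map (CommRingCat.ofHom f))
        (wittQuotToResidue_comp_algebraMap p k 0).symm)

/-- `X_k ⟶ X_0 ⟶ 𝒳` is `X_k ⟶ 𝒳`. [folklore] -/
@[reassoc]
theorem specialFibreToTower_ι (𝒳 : SchemeOver (WittVector p k)) :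
    specialFibreToTower 𝒳 ≫ KTheory.thickeningι (Ideal.span {(p : WittVector p k)}) 𝒳 0 =
      specialFibreι 𝒳 :=
  (pullback.lift_fst _ _ _).trans (Category.comp_id _)

end Tower

/-! ## Theorem 1.3 as a predicate of the realization -/

section BEK

variable {p : ℕ} [Fact p.Prime] {k : Type u} [Field k] [CharP k p] [PerfectRing k p]

/-- **Bloch–Esnault–Kerz 2014, Theorem 1.3** (the `p`-adic deformation criterion for
`K₀ ⊗ ℚ`-classes), as a property of the crystalline realization `C` (named-fact pattern of
`Motives/CrystallineRealization`: a theorem for THE classical realization, consumed as a hypothesis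
`(h : BlochEsnaultKerzLifting C)`, not asserted for every `C`): for `k` perfect of characteristic
`p`, `𝒳/W(k)` smooth projective of relative dimension `d` (here: `IsSmoothProperModel d 𝒳` and
`IsProjectiveOverRing 𝒳`) with `p > d + 6`, and `ξ₁ ∈ K₀(X₁)_ℚ` on the closed fibre
`X₁ = 𝒳 ⊗_W k`, the following are equivalent: (a) `Φ⁻¹ ∘ ch(ξ₁) ∈ ⊕ᵣ Fʳ H²ʳ_dR(X_K/K)`
(`C.HodgeConditionKZeroRat 𝒳 ξ₁`); (b) there is `ξ̂ ∈ (lim_n K₀(X_n))_ℚ`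
(`ContinuousKZeroRat (p) 𝒳`) with `ξ̂|_{X₁} = ξ₁` in `K₀(X₁)_ℚ` (restriction to `𝒳 ⊗_W W/p`,
`ContinuousKZeroRat.specialFibre`, pulled back along the canonical isomorphism
`𝒳 ⊗_W k → 𝒳 ⊗_W W/p`, `specialFibreToTower 𝒳`).
[cite: BlochEsnaultKerz2014pAdic, Thm. 1.3] -/
def BlochEsnaultKerzLifting (C : CrystallineRealization p k) : Prop :=
  ∀ ⦃d : ℕ⦄ ⦃𝒳 : SchemeOver (WittVector p k)⦄, IsSmoothProperModel d 𝒳 →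
    IsProjectiveOverRing 𝒳 → d + 6 < p →
    ∀ ξ₁ : KZeroRat (specialFibre 𝒳).left,
      C.HodgeConditionKZeroRat 𝒳 ξ₁ ↔
        ∃ ξ : ContinuousKZeroRat (Ideal.span {(p : WittVector p k)}) 𝒳,
          KZeroRat.map (specialFibreToTower 𝒳)
            (ContinuousKZeroRat.specialFibre (Ideal.span {(p : WittVector p k)}) 𝒳 ξ) = ξ₁

variable (C : CrystallineRealization p k) {d : ℕ} {𝒳 : SchemeOver (WittVector p k)}

/-- **(b) ⇒ (a) for classes that algebraize** (the elementary direction, from the comparison axiom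
`bo_chCris` of the structure): the restriction `ξ|_{X₁} ∈ K₀(X₁)_ℚ` of any `ξ ∈ K₀(𝒳)_ℚ` on a smooth
proper `𝒳/W` satisfies condition (a) (Bloch–Esnault–Kerz 2014, §1: the composite
`K₀(X) → lim K₀(X_n) → K₀(X₁)`). [cite: BlochEsnaultKerz2014pAdic, §1 and Thm. 1.3] -/
theorem hodgeConditionKZeroRat_map_specialFibreι (h𝒳 : IsSmoothProperModel d 𝒳)
    (ξ : KZeroRat 𝒳.left) :
    C.HodgeConditionKZeroRat 𝒳 (KZeroRat.map (specialFibreι 𝒳) ξ) := by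
  intro r
  induction ξ using TensorProduct.induction_on with
  | zero => simp
  | tmul a x =>
    rw [KZeroRat.map_tmul, C.chKZeroRat_tmul, map_smul]
    refine Submodule.smul_mem _ _ ?_
    refine KZero.induction_on (p := fun x => C.bo 𝒳 (2 * r)
      (C.chKZero (specialFibre 𝒳) r (KZero.map (specialFibreι 𝒳) x)) ∈ C.dR.fil (2 * r) r)
      x ?_ ?_ ?_ ?_
    · simp
    · intro E hE
      rw [KZero.map_of, C.chKZero_of]
      exact C.hodgeCondition_restrictSpecial h𝒳 E hE.isVectorBundle r
    · intro x hx
      simpa using Submodule.neg_mem _ hx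
    · intro x y hx hy
      simpa using Submodule.add_mem _ hx hy
  | add ξ η hξ hη => simpa [map_add] using Submodule.add_mem _ hξ hη

omit [PerfectRing k p] in
/-- Classes that algebraize lift to the tower: for `ξ ∈ K₀(𝒳)_ℚ`, `ξ̂ := (ξ|_{X_n})_n` satisfies
`ξ̂|_{X₁} = ξ|_{X₁}` (condition (b) of Thm. 1.3 for `ξ₁ = ξ|_{X₁}`; Bloch–Esnault–Kerz 2014, §1, the
diagram `K₀(X) → lim_n K₀(X_n) → K₀(X₁)`). [cite: BlochEsnaultKerz2014pAdic, §1] -/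
theorem exists_lift_of_map_specialFibreι (ξ : KZeroRat 𝒳.left) :
    ∃ ξhat : ContinuousKZeroRat (Ideal.span {(p : WittVector p k)}) 𝒳,
      KZeroRat.map (specialFibreToTower 𝒳)
        (ContinuousKZeroRat.specialFibre (Ideal.span {(p : WittVector p k)}) 𝒳 ξhat) =
          KZeroRat.map (specialFibreι 𝒳) ξ := by
  refine ⟨ContinuousKZeroRat.restrict (Ideal.span {(p : WittVector p k)}) 𝒳 ξ, ?_⟩
  rw [ContinuousKZeroRat.proj_restrict, ← KZeroRat.map_comp_apply, specialFibreToTower_ι]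

/-- Under `BlochEsnaultKerzLifting C`, a class `ξ₁ ∈ K₀(X₁)_ℚ` with vanishing Hodge obstruction
lifts to `(lim_n K₀(X_n))_ℚ` (direction (a) ⇒ (b) of Thm. 1.3, the one the consuming route uses).
[cite: BlochEsnaultKerz2014pAdic, Thm. 1.3] -/
theorem exists_lift_of_hodgeConditionKZeroRat (h : BlochEsnaultKerzLifting C)
    (h𝒳 : IsSmoothProperModel d 𝒳) (hproj : IsProjectiveOverRing 𝒳) (hp : d + 6 < p)
    {ξ₁ : KZeroRat (specialFibre 𝒳).left} (hξ : C.HodgeConditionKZeroRat 𝒳 ξ₁) :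
    ∃ ξ : ContinuousKZeroRat (Ideal.span {(p : WittVector p k)}) 𝒳,
      KZeroRat.map (specialFibreToTower 𝒳)
        (ContinuousKZeroRat.specialFibre (Ideal.span {(p : WittVector p k)}) 𝒳 ξ) = ξ₁ :=
  (h h𝒳 hproj hp ξ₁).mp hξ

end BEK

end Literature.AlgebraicGeometry.Crystalline

end
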